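import Summits.BirchSwinnertonDyer.BirchSwinnertonDyer.Theses.KolyvaginRoadThree
import Summits.BirchSwinnertonDyer.Rank1Residual.X11b.Three.ZhangAtThreeNonsplit
import HarnessLib

/-!
# Route `KolyvaginRoadThree` — the deciding crux `ZhangSharpFrameAtThree` IS the ∀-closure of the tree
# conjecture `Koly.ZhangAtThreeSharpFrame` (frame bridge; `--supports stmt-BirchSwinnertonDyer-19153`)

Cell `bsd-stepL` (run/shared/lean/pub/bsd-stepL/), seat `bsd-stepL-koly` (prover, Kolyvagin road), planner
ruling (R-an)(1). The deciding crux of `route-BirchSwinnertonDyer-KolyvaginRoadThree` (item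
`stmt-BirchSwinnertonDyer-19153`, `Theses.KolyvaginRoadThree.ZhangSharpFrameAtThree`) was typed by the planner
as the hypothesis `hZ` of the landed A1 kernel `Koly.bsdp_three_onA1_of_kolyvaginFrames`
(`Theorems/ClassRecordThreeKolyGlue.lean`, koly p410690) VERBATIM, with the tree abbreviations
`Rank1Residual.Surj W 3` (= `W.HasSurjectiveModNGaloisRep 3`) and `Rank1Residual.Ram W 3` (= the (ram) witness
`∃ ℓ prime, ℓ ≠ 3 ∧ mult at ℓ ∧ 3 ∤ ord_ℓ Δ_min`) in place of their unfoldings. The tree's typed conjecture is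
`Koly.ZhangAtThreeSharpFrame W K` (X11b/Three/ZhangAtThreeNonsplit.lean, koly p411122: Kolyvagin's conjecture
mod 3 at `3 ∥ N` on A1 at EVERY Manin-good conductor-1 frame `(Dt, β, ι)`). This file records, sorry-free, that
the two are the SAME statement up to binder order:

* `zhangSharpFrameAtThree_iff_forall_zhangAtThreeSharpFrame` — crux `↔ ∀ W K, Koly.ZhangAtThreeSharpFrame W K`;
* the two directions as named implications (what a prover of either side cites);
* `zhangAtThreeSharp_onA1_of_zhangSharpFrameAtThree` — the crux gives the ∃-frame conjecture of record
  `Koly.ZhangAtThreeSharp W K` (Z₃♯, koly p408750) at every pair, via `Koly.zhangAtThreeSharp_of_frame`, as soon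
  as ONE Manin-good frame exists (the consumer always has one: Mazur's Manin bound at the optimal frame).

Consequence for the line: a proof of `∀ W K, Koly.ZhangAtThreeSharpFrame W K` (the object the cell's memo chain
MEMO-v2 → v4 → v6 attacks: level-raising at 3, mod-3 multiplicity one, W. Zhang's induction on Kolyvagin primes)
closes item 19153 by `zhangSharpFrameAtThree_of_forall_zhangAtThreeSharpFrame`, and a refutation of the tree
conjecture at one pair `(W, K)` refutes the crux by `forall_zhangAtThreeSharpFrame_of_zhangSharpFrameAtThree`.
Pure logic; nothing is asserted about either statement; CONDITIONAL on its hypotheses throughout. HONEST FRAMING: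
bookkeeping for the deciding crux — no class of atom O2@3 moves (PARTITION: O2@3 × A1 (1 116 TRUE-OPEN classes) —
types-the-object-of; closes: none).

References: [WZhang2014] W. Zhang, *Selmer groups and the indivisibility of Heegner points*, Camb. J. Math. 2
(2014) 191–253, Thm. 1.1 (p. 195), §3 (p. 211: (𝒪,𝔭)-optimal parametrisations); [GrossLMS1991] B. H. Gross,
*Kolyvagin's work on modular elliptic curves*, LMS LNS 153 (1991) 235–256, §§3–4.
-/

noncomputable section

open scoped Classical

namespace Summit.BirchSwinnertonDyer.BirchSwinnertonDyer.Theorems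

open WeierstrassCurve Literature.NumberTheory.EllipticCurves
  Literature.NumberTheory.EllipticCurves.ModularForms
  Literature.NumberTheory.EllipticCurves.Rank1Residual
  Summit.BirchSwinnertonDyer.Rank1Residual.X11b.Three

/-- **The deciding crux gives the tree conjecture at every pair**: `ZhangSharpFrameAtThree → ∀ W K,
Koly.ZhangAtThreeSharpFrame W K` (binder re-ordering; `Surj`∕`Ram` are the tree abbreviations of the conjecture's
second and third hypotheses). [folklore] -/
theorem forall_zhangAtThreeSharpFrame_of_zhangSharpFrameAtThree
    (h : Summit.BirchSwinnertonDyer.BirchSwinnertonDyer.Theses.KolyvaginRoadThree.ZhangSharpFrameAtThree)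
    (W : WeierstrassCurve ℚ) [W.IsElliptic] [W.IsGloballyMinimal] [NeZero (W.conductorNorm ℤ)]
    (K : Type) [Field K] [NumberField K] : Koly.ZhangAtThreeSharpFrame W K :=
  fun hmult hρ hram htam hK hH h3 Dt β ι hβ hc ↦
    h W K Dt β ι hmult hρ hram htam hK hH h3 hβ hc

/-- **The tree conjecture at every pair gives the deciding crux**: `(∀ W K, Koly.ZhangAtThreeSharpFrame W K) →
ZhangSharpFrameAtThree` (binder re-ordering; equivalently `Koly.kolyvaginFrames_of_forall_zhangAtThreeSharpFrame`,
whose conclusion is the crux with `Surj`∕`Ram` unfolded). [folklore] -/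
theorem zhangSharpFrameAtThree_of_forall_zhangAtThreeSharpFrame
    (h : ∀ (W : WeierstrassCurve ℚ) [W.IsElliptic] [W.IsGloballyMinimal] [NeZero (W.conductorNorm ℤ)]
      (K : Type) [Field K] [NumberField K], Koly.ZhangAtThreeSharpFrame W K) :
    Summit.BirchSwinnertonDyer.BirchSwinnertonDyer.Theses.KolyvaginRoadThree.ZhangSharpFrameAtThree :=
  fun W _ _ _ K _ _ Dt β ι hmult hρ hram htam hK hH h3 hβ hc ↦
    h W K hmult hρ hram htam hK hH h3 Dt β ι hβ hc

/-- **Frame bridge**: the deciding crux `ZhangSharpFrameAtThree` of route `KolyvaginRoadThree` is EQUIVALENT to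
the ∀-closure of the tree conjecture `Koly.ZhangAtThreeSharpFrame` (Kolyvagin's conjecture mod 3 at `3 ∥ N` on A1
at every Manin-good conductor-1 frame). Pure logic. [folklore] -/
theorem zhangSharpFrameAtThree_iff_forall_zhangAtThreeSharpFrame :
    Summit.BirchSwinnertonDyer.BirchSwinnertonDyer.Theses.KolyvaginRoadThree.ZhangSharpFrameAtThree ↔
      ∀ (W : WeierstrassCurve ℚ) [W.IsElliptic] [W.IsGloballyMinimal] [NeZero (W.conductorNorm ℤ)]
        (K : Type) [Field K] [NumberField K], Koly.ZhangAtThreeSharpFrame W K :=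
  ⟨fun h W _ _ _ K _ _ ↦ forall_zhangAtThreeSharpFrame_of_zhangSharpFrameAtThree h W K,
    zhangSharpFrameAtThree_of_forall_zhangAtThreeSharpFrame⟩

/-- **The crux gives the ∃-frame conjecture of record Z₃♯ (`Koly.ZhangAtThreeSharp W K`) at every pair with a
Manin-good frame**: supply the frame `(Dt, β, ι)` (`4N ∣ β² − d_K`, `3 ∤ c(Dt)`) to
`Koly.zhangAtThreeSharp_of_frame`. [folklore] -/
theorem zhangAtThreeSharp_of_zhangSharpFrameAtThree
    (h : Summit.BirchSwinnertonDyer.BirchSwinnertonDyer.Theses.KolyvaginRoadThree.ZhangSharpFrameAtThree)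
    (W : WeierstrassCurve ℚ) [W.IsElliptic] [W.IsGloballyMinimal] [NeZero (W.conductorNorm ℤ)]
    (K : Type) [Field K] [NumberField K] (Dt : ModularParametrizationData W (W.conductorNorm ℤ)) (β : ℤ)
    (ι : K →+* ℂ) (hβ : (4 * (W.conductorNorm ℤ : ℤ)) ∣ β ^ 2 - NumberField.discr K) (hc : ¬ (3 : ℤ) ∣ Dt.c) :
    Koly.ZhangAtThreeSharp W K :=
  Koly.zhangAtThreeSharp_of_frame W K (forall_zhangAtThreeSharpFrame_of_zhangSharpFrameAtThree h W K) Dt β ι hβ hc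

end Summit.BirchSwinnertonDyer.BirchSwinnertonDyer.Theorems

end
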